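import Literature.AlgebraicGeometry.Motives.CrystallineRealization
import Literature.AlgebraicGeometry.Motives.ChernClassesProofs
import Literature.AlgebraicGeometry.Motives.SupersingularAbelianVariety
import Literature.AlgebraicGeometry.Motives.HodgeSheaves
import Literature.AlgebraicGeometry.Deformation.VectorBundleExtensionObstruction

/-!
# Sketch — crux-ideate round 1, ideator 3, crux `SemiregularSeedsOnAnchors` (stmt-HodgeConjecture-13941)

First lemmas of the three crux idea cards of this seat
(`Ideas/isogeny-untwist-superspecial.md` (A), `Ideas/milne-split.md` (B),
`Ideas/gorenstein-ci-seeds.md` (C)), stated over EXISTING declarations only: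
real carriers `obstructionGroup 2 E 𝒪 = Ext²(E, E ⊗ 𝒪)` (Mathlib `Ext` in `X.Modules`),
`hodgeCohomology X a b = Hᵇ(X, Ωᵃ)`, the `WittScheme` tower, `CrystallineRealization`
(`bo`, `dR.fil`, `chCris`, `HodgeCondition`, `ratAlgebraicClasses`), `WeilCohomology.lefschetzClasses`,
`AbelianVariety.IsSupersingularEllipticCurve / powSucc`.
The crystalline Buchweitz–Flenner maps `σ_q` have no constructed carrier in the tree; as in the
sister crux's sketches they enter as DATA (`AtiyahTracePackage`), so every statement mentioning them
is a predicate of that data. Nothing here is filed; provers never see this file.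
-/

noncomputable section

open CategoryTheory AlgebraicGeometry
open scoped Isocrystal
open Literature.AlgebraicGeometry.Motives Literature.AlgebraicGeometry.Motives.WittScheme
open Literature.AlgebraicGeometry.Deformation

universe u

set_option linter.dupNamespace false

namespace Summit.HodgeConjecture.HodgeConjecture.Cruxes.SemiregularSeedsOnAnchors.IdeatorThree

/-! ## Common vocabulary -/

/-- A crystalline Buchweitz–Flenner package on REAL carriers: for every `k`-scheme `X`, every
`𝒪_X`-module `E` and every `q`, an additive map `σ_q : Ext²(E, E ⊗ 𝒪_X) → H^{q+2}(X, Ω^q_{X/k})`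
(intended: `tr(At(E)^q ∘ −)/q!`, `q < p`). Source and target are the tree's real groups. -/
structure AtiyahTracePackage (k : Type u) [CommRing k] where
  /-- `σ_q` on `Ext²(E, E ⊗ 𝒪_X)`. -/
  sigma : ∀ (X : SchemeOver k) (E : X.left.Modules) (q : ℕ),
    obstructionGroup 2 E (structureSheafModule X.left) →+ hodgeCohomology X q (q + 2)

/-- `E` is p-ADICALLY SEMIREGULAR for the package `Θ`: `⊕_{q<p} σ_q` is injective on `Ext²(E, E ⊗ 𝒪)`
(the crux's notion, verbatim). -/
def AtiyahTracePackage.IsPadicSemiregular {k : Type u} [CommRing k] (Θ : AtiyahTracePackage k)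
    (p : ℕ) (X : SchemeOver k) (E : X.left.Modules) : Prop :=
  ∀ x : obstructionGroup 2 E (structureSheafModule X.left), (∀ q, q < p → Θ.sigma X E q x = 0) → x = 0

/-! ## Card A — `isogeny-untwist-superspecial`

(A1) The ISOGENY-PULLBACK CRITERION in its linear-algebra form. For an étale isogeny `f : Y' → Y`
of abelian varieties with kernel dual `Ĝ`, `Ext²(f*E, f*E) = ⊕_{χ ∈ Ĝ} Ext²(E, E ⊗ P_χ)` and the
semiregularity map of `f*E` kills every summand `χ ≠ 0` (its target `H^{q+2}(Y, Ω^q ⊗ P_χ)` is zero).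
Abstractly: a map out of a finite direct sum that vanishes off the summand `i₀` is injective iff it is
injective on the summand `i₀` AND all other summands are zero. -/

theorem injective_iff_of_offDiagonal_vanishing {K : Type*} [Field K] {ι : Type*} [DecidableEq ι]
    (i₀ : ι) {V : ι → Type*} [∀ i, AddCommGroup (V i)] [∀ i, Module K (V i)]
    {W : Type*} [AddCommGroup W] [Module K W] (σ : (∀ i, V i) →ₗ[K] W)
    (hσ : ∀ i, i ≠ i₀ → ∀ v : V i, σ (Pi.single i v) = 0) :
    Function.Injective σ ↔
      Function.Injective (σ ∘ₗ LinearMap.single K V i₀) ∧ ∀ i, i ≠ i₀ → ∀ v : V i, v = 0 := by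
  constructor
  · intro hinj
    refine ⟨?_, ?_⟩
    · intro a b hab
      have h : (Pi.single i₀ a : ∀ i, V i) = Pi.single i₀ b := hinj (by simpa using hab)
      exact Pi.single_injective (M := V) i₀ h
    · intro i hi v
      have h0 : σ (Pi.single i v) = σ 0 := by rw [hσ i hi v, map_zero]
      have h1 : (Pi.single i v : ∀ i, V i) = 0 := hinj h0
      have h2 : (Pi.single i v : ∀ i, V i) i = (0 : ∀ i, V i) i := by rw [h1]
      simpa using h2
  · rintro ⟨h₀, hv⟩
    rw [injective_iff_map_eq_zero]
    intro z hz
    have hz' : z = Pi.single i₀ (z i₀) := by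
      funext i
      by_cases hi : i = i₀
      · subst hi; simp
      · rw [hv i hi (z i), Pi.single_eq_of_ne hi]
    have h3 : (σ ∘ₗ LinearMap.single K V i₀) (z i₀) = 0 := by
      simpa [← hz'] using hz
    have h4 : z i₀ = 0 := by
      rw [← map_zero (σ ∘ₗ LinearMap.single K V i₀)] at h3
      exact h₀ h3
    rw [hz', h4, Pi.single_zero]

/-- (A2) SUPERSPECIAL UNIFORMIZATION (Deligne, Ogus, Shioda; Ibukiyama–Katsura 1994 §1): over an
algebraically closed field, any two products of `n + 1 ≥ 2` supersingular elliptic curves are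
isomorphic. Typed as a NAMED-FACT-shaped `Prop` over the tree's `AbelianVariety.powSucc`; to be
vendored under `Literature/AlgebraicGeometry/Motives` if the line is pursued (not claimed here). -/
def SuperspecialUniformization (k : Type u) [Field k] [IsAlgClosed k] : Prop :=
  ∀ (E E' : AbelianVariety k), E.IsSupersingularEllipticCurve → E'.IsSupersingularEllipticCurve →
    ∀ n : ℕ, 1 ≤ n → Nonempty ((E.powSucc n).X ≅ (E'.powSucc n).X)

section Witt

variable {p : ℕ} [Fact p.Prime] {k : Type u} [Field k] [CharP k p] [PerfectRing k p]

/-! ## Card B — `milne-split`: crux = (R_K) F-rationality ∧ (S) semiregular representability -/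

/-- The F-RATIONAL algebraic classes of the special fibre of `𝒳/W` in codimension `r`: rational
algebraic (crystalline) classes of `X_k` carried by Berthelot–Ogus into `Fʳ H²ʳ_dR(X_K/K)`
("p-adically Hodge cycles of the special fibre"; by Bloch–Esnault–Kerz exactly the rational classes
whose `K₀`-class lifts `p`-adically continuously). -/
def FRational (C : CrystallineRealization p k) (𝒳 : SchemeOver (WittVector p k)) (r : ℕ) :
    Set (C.obj (specialFibre 𝒳) (2 * r)) :=
  {x | x ∈ C.ratAlgebraicClasses (specialFibre 𝒳) r ∧ C.bo 𝒳 (2 * r) x ∈ C.dR.fil (2 * r) r}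

/-- (R_K) K-SPAN RATIONALITY of a de Rham class `α` on the generic fibre: `α` lies in the `K`-span of
the Berthelot–Ogus images of F-rational classes plus the Lefschetz classes of `X_K`. At the route's
anchors this is a Milne-type rationality statement (constant on the residue disc, hence an instance
of `MilneRationalityConjecture`'s `p`-component at `ℚ^al`-points of the disc). -/
def KSpanRational (C : CrystallineRealization p k) (𝒳 : SchemeOver (WittVector p k)) (r : ℕ)
    (α : C.dR.obj (genericFibre 𝒳) (2 * r)) : Prop :=
  α ∈ Submodule.span K(p, k) (C.bo 𝒳 (2 * r) '' FRational C 𝒳 r) ⊔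
    C.dR.lefschetzClasses (genericFibre 𝒳) r

/-- (S) SEMIREGULAR REPRESENTABILITY of the F-rational classes: finitely many `Θ`-semiregular finite
locally free `E_i` on `X_k` with the BEK Hodge condition whose `chᵣ^cris` span every F-rational class
modulo Lefschetz classes of `X_K`. No `α`, no Hodge origin, no embedding `K → ℂ` occurs. -/
def SemiregularRepresentability (C : CrystallineRealization p k) (Θ : AtiyahTracePackage k)
    (𝒳 : SchemeOver (WittVector p k)) (r : ℕ) : Prop :=
  ∃ (m : ℕ) (E : Fin m → (specialFibre 𝒳).left.Modules),
    (∀ i, IsFiniteLocallyFree (E i) ∧ Θ.IsPadicSemiregular p (specialFibre 𝒳) (E i) ∧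
      C.HodgeCondition 𝒳 (E i)) ∧
    C.bo 𝒳 (2 * r) '' FRational C 𝒳 r ⊆
      ↑(Submodule.span K(p, k) (Set.range fun i => C.bo 𝒳 (2 * r) (C.chCris (specialFibre 𝒳) (E i) r)) ⊔
        C.dR.lefschetzClasses (genericFibre 𝒳) r)

/-- The crux's CONCLUSION SHAPE for one `(𝒳, r, α)` (the crux item is informal; this is its literal
conclusion "α ∈ K-span{bo chᵣ^cris(E_i)} + Lefʳ(X_K)" over the real carriers, seeds as above). -/
def SeedSpan (C : CrystallineRealization p k) (Θ : AtiyahTracePackage k)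
    (𝒳 : SchemeOver (WittVector p k)) (r : ℕ) (α : C.dR.obj (genericFibre 𝒳) (2 * r)) : Prop :=
  ∃ (m : ℕ) (E : Fin m → (specialFibre 𝒳).left.Modules),
    (∀ i, IsFiniteLocallyFree (E i) ∧ Θ.IsPadicSemiregular p (specialFibre 𝒳) (E i) ∧
      C.HodgeCondition 𝒳 (E i)) ∧
    α ∈ Submodule.span K(p, k) (Set.range fun i => C.bo 𝒳 (2 * r) (C.chCris (specialFibre 𝒳) (E i) r)) ⊔
      C.dR.lefschetzClasses (genericFibre 𝒳) r

/-- (B1) FACTORIZATION LEMMA: `(R_K) ∧ (S) ⇒` the crux's conclusion for `α` (pure linear algebra). -/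
theorem seedSpan_of_kSpanRational_of_representability (C : CrystallineRealization p k)
    (Θ : AtiyahTracePackage k) (𝒳 : SchemeOver (WittVector p k)) (r : ℕ)
    (α : C.dR.obj (genericFibre 𝒳) (2 * r))
    (hR : KSpanRational C 𝒳 r α) (hS : SemiregularRepresentability C Θ 𝒳 r) :
    SeedSpan C Θ 𝒳 r α := by
  obtain ⟨m, E, hE, hsub⟩ := hS
  refine ⟨m, E, hE, ?_⟩
  have h1 : Submodule.span K(p, k) (C.bo 𝒳 (2 * r) '' FRational C 𝒳 r) ≤
      Submodule.span K(p, k) (Set.range fun i => C.bo 𝒳 (2 * r) (C.chCris (specialFibre 𝒳) (E i) r)) ⊔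
        C.dR.lefschetzClasses (genericFibre 𝒳) r :=
    Submodule.span_le.mpr hsub
  exact (sup_le h1 le_sup_right) hR

/-- (B2) The converse direction that makes (R_K) a GENUINE sub-crux: the crux's conclusion implies
K-span rationality, because `chᵣ^cris` of a module on the smooth projective special fibre is a rational
algebraic class (`chCris_mem_ratAlgebraicClasses`) and the Hodge condition puts it in `Fʳ`. -/
theorem kSpanRational_of_seedSpan (C : CrystallineRealization p k) (Θ : AtiyahTracePackage k)
    {n : ℕ} (𝒳 : SchemeOver (WittVector p k)) (h𝒳 : IsSmoothProperModel n 𝒳) (r : ℕ)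
    (α : C.dR.obj (genericFibre 𝒳) (2 * r)) (h : SeedSpan C Θ 𝒳 r α) :
    KSpanRational C 𝒳 r α := by
  obtain ⟨m, E, hE, hα⟩ := h
  have h1 : Submodule.span K(p, k) (Set.range fun i => C.bo 𝒳 (2 * r) (C.chCris (specialFibre 𝒳) (E i) r)) ≤
      Submodule.span K(p, k) (C.bo 𝒳 (2 * r) '' FRational C 𝒳 r) := by
    refine Submodule.span_mono ?_
    rintro _ ⟨i, rfl⟩
    refine ⟨C.chCris (specialFibre 𝒳) (E i) r, ⟨?_, (hE i).2.2 r⟩, rfl⟩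
    exact C.chCris_mem_ratAlgebraicClasses h𝒳.isSmoothProjective_specialFibre (E i) r
  exact (sup_le_sup_right h1 _) hα

/-! ## Card C — `gorenstein-ci-seeds` (Fermat anchors) -/

omit [Fact p.Prime] [CharP k p] [PerfectRing k p] in
/-- (C1) On a fourfold anchor whose Hodge groups `H^{q+2}(X, Ω^q)` vanish for `q ≠ 1` (smooth
hypersurface fourfolds: `h^{0,2} = h^{2,4} = 0`), p-adic semiregularity is injectivity of the SINGLE
component `σ₁ : Ext²(E,E) → H³(X, Ω¹) = H^{1,3}`. -/
theorem isPadicSemiregular_iff_sigma_one (Θ : AtiyahTracePackage k) (hp : 1 < p) (X : SchemeOver k)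
    (E : X.left.Modules)
    (hvan : ∀ q, q ≠ 1 → q < p → ∀ y : hodgeCohomology X q (q + 2), y = 0) :
    Θ.IsPadicSemiregular p X E ↔ Function.Injective (Θ.sigma X E 1) := by
  constructor
  · intro h
    rw [injective_iff_map_eq_zero]
    intro x hx
    refine h x fun q hq => ?_
    by_cases hq1 : q = 1
    · subst hq1; exact hx
    · exact hvan q hq1 hq _
  · intro hinj x hx
    exact (injective_iff_map_eq_zero _).mp hinj x (hx 1 hp)

/-- (C2) EQUIVARIANT FORCED KERNEL (the mechanism behind "`H_a`-stable seeds must have no invariant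
self-Ext²"): if a group acts on source and target, `σ` is equivariant and injective, and the target
has no non-zero invariants, then the source has no non-zero invariants. -/
theorem invariants_eq_zero_of_equivariant_injective {K G V W : Type*} [Field K] [Group G]
    [AddCommGroup V] [Module K V] [AddCommGroup W] [Module K W]
    (ρV : G →* (V →ₗ[K] V)) (ρW : G →* (W →ₗ[K] W)) (σ : V →ₗ[K] W)
    (hσ : ∀ g v, σ (ρV g v) = ρW g (σ v)) (hinj : Function.Injective σ)
    (hW : ∀ w : W, (∀ g, ρW g w = w) → w = 0) :
    ∀ v : V, (∀ g, ρV g v = v) → v = 0 := by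
  intro v hv
  apply hinj
  rw [map_zero]
  refine hW (σ v) fun g => ?_
  rw [← hσ, hv]

end Witt

end Summit.HodgeConjecture.HodgeConjecture.Cruxes.SemiregularSeedsOnAnchors.IdeatorThree

end
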